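import Literature.MathematicalPhysics.QuantumLattice.WightmanPermutedTubeConnectedProofs
import Literature.MathematicalPhysics.QuantumLattice.RestrictedLorentzConnected
import HarnessLib

/-!
# The symmetric continuation in four dimensions: status after the discharge of (C)

Topic `Literature/MathematicalPhysics/QuantumLattice` (trunk T-AQFT), bookkeeping file in the
decomposition of the named fact (K) `IsWightmanQFT.extendedTube_continuation_perm_eq`
(`WightmanPermutedTube`; Osterwalder–Schrader I §5 p. 97, citing Jost (1965) p. 83). Its
four-dimensional instance (K₄) `IsWightmanQFT.extendedTube_continuation_perm_eq_dim4`
(`WightmanPermutedTubeConnected`) was reduced in `WightmanPermutedTubeSlices` to the two classical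
facts (N) `ComplexLorentz.properComplexLorentz_normalForm` (normal forms of `L₊(ℂ)`,
Streater–Wightman (2-87)–(2-88)) and (C) `ComplexLorentz.restrictedLorentzGroup_isPathConnected`
(Streater–Wightman §1-2), and (C) is proved in `RestrictedLorentzConnected`. Hence **(K₄), and
Tomozawa's connectedness theorem (T) `isConnected_relExtendedTube_inter_perm`, now rest on the
single named fact (N)**:

* `isConnected_relExtendedTube_inter_perm_of_normalForm_only : (N) → (T)`;
* `IsWightmanQFT.extendedTube_continuation_perm_eq_dim4_of_normalForm_only : (N) → (K₄)`;
* `IsWightmanQFT.exists_symmetric_continuation_dim4_of_normalForm`,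
  `IsWickRotationOf.schwinger_symmetric_dim4_of_normalForm`: with the Bargmann–Hall–Wightman
  continuation (A), the symmetric continuation and the symmetry of the Schwinger functions in four
  dimensions follow from (N).

## Sources

* K. Osterwalder, R. Schrader, Comm. Math. Phys. 31 (1973), §5 p. 97. [OsterwalderSchraderCMP1973]
* Y. Tomozawa, J. Math. Phys. 4 (1963) 1240–1252. [Tomozawa1963]
* R. F. Streater, A. S. Wightman, *PCT, Spin and Statistics, and All That*, §1-2 (1-9), §2-4
  (2-87)–(2-88). [StreaterWightman1964]
-/

noncomputable section

namespace Literature.MathematicalPhysics.QuantumLattice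

open ComplexLorentz LorentzConnected

/-- **(N) ⇒ Tomozawa's theorem (T)**, the connectedness (C) of `L↑₊` being proved
(`restrictedLorentzGroup_isPathConnected_holds`). [folklore] -/
theorem isConnected_relExtendedTube_inter_perm_of_normalForm_only
    (hN : properComplexLorentz_normalForm) : isConnected_relExtendedTube_inter_perm :=
  isConnected_relExtendedTube_inter_perm_of_normalForm hN restrictedLorentzGroup_isPathConnected_holds

/-- **(N) ⇒ (K₄)**: the consistency of the Bargmann–Hall–Wightman continuation under permutations
in four space-time dimensions follows from the normal forms of `L₊(ℂ)` alone
(Streater–Wightman (2-87)–(2-88)), everything else being proved in the tree. [folklore] -/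
theorem IsWightmanQFT.extendedTube_continuation_perm_eq_dim4_of_normalForm_only {κ : Type*}
    (hN : properComplexLorentz_normalForm) :
    IsWightmanQFT.extendedTube_continuation_perm_eq_dim4 (κ := κ) :=
  IsWightmanQFT.extendedTube_continuation_perm_eq_dim4_of_normalForm hN
    restrictedLorentzGroup_isPathConnected_holds

/-- **The symmetric continuation in four dimensions from (A) and (N).** [folklore] -/
theorem IsWightmanQFT.exists_symmetric_continuation_dim4_of_normalForm {κ : Type*}
    (hA : IsWightmanQFT.exists_invariant_continuation (d := 3) (κ := κ))
    (hN : properComplexLorentz_normalForm) :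
    IsWightmanQFT.exists_symmetric_continuation (d := 3) (κ := κ) :=
  IsWightmanQFT.exists_symmetric_continuation_of_perm_eq hA
    (IsWightmanQFT.extendedTube_continuation_perm_eq_dim4_of_normalForm_only hN)

/-- **Symmetry and real analyticity of the Schwinger functions in four dimensions from (A) and
(N).** [folklore] -/
theorem IsWickRotationOf.schwinger_symmetric_dim4_of_normalForm {κ : Type*}
    (hA : IsWightmanQFT.exists_invariant_continuation (d := 3) (κ := κ))
    (hN : properComplexLorentz_normalForm) :
    IsWickRotationOf.schwinger_symmetric (d := 3) (κ := κ) :=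
  IsWickRotationOf.schwinger_symmetric_of_perm_eq hA
    (IsWightmanQFT.extendedTube_continuation_perm_eq_dim4_of_normalForm_only hN)

end Literature.MathematicalPhysics.QuantumLattice
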